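import Literature.NumberTheory.GaloisRepresentations.TateDualLimitPairingSumFormula
import Literature.NumberTheory.IwasawaTheory.Greenberg2016.RestrictedRamificationBridge
import Literature.NumberTheory.IwasawaTheory.Greenberg2016.GlobalToLocalSurjectivityProofs
import Literature.NumberTheory.GaloisCohomology.ArchimedeanInvariantMap
import HarnessLib

/-!
# Greenberg 2010 Prop. 3.1.1, easy half: the pairing of `S_{𝓛*}(K, T*)` with `coker(φ_𝓛)` and its
# kernel (definitions with bodies + theorems)

Topic `NumberTheory/IwasawaTheory/Greenberg2016`; namespace
`Literature.NumberTheory.IwasawaTheory.Greenberg2016`.  Definitions WITH BODIES and theorems; no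
named fact, no `sorry`, no instance, no notation.  Lane «SUR-Λ» of cell `bsd-eis` (road memo
`SUR-LAMBDA-ROAD-w5g9.md` §2 ★(3.1.1-easy)/(β), brick C5c part 1), `--supports stmt-BirchSwinnertonDyer-19032`.

MATHEMATICS.  R. Greenberg, *Surjectivity of the global-to-local map defining a Selmer group*,
Kyoto J. Math. 50 (2010), §3.1 p. 14: "By definition, the cokernel of `φ_𝓛` is isomorphic to
`P/GL`.  The pairing (9) shows that its Pontryagin dual is isomorphic to `G* ∩ L*` … the image of
`S_{𝓛*}(K, T*)`", whence Prop. 3.1.1 `coker(φ_𝓛)^∧ ≅ S_{𝓛*}(K, T*)/Ш¹(K, Σ, T*)`.  This file builds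
the map behind the EASY inclusion — all that Prop. 3.2.1 uses —

  `y ↦ (t ↦ ∑_{v ∈ Σ} ⟪t_v, y_v⟫_v) : {y : loc_v y ∈ L_v^⊥ (v ∈ Σ)} → Hom(coker φ_𝓛, ℚ/ℤ)`,

in the Greenberg-2016 dictionary (`ρ : ContinuousRep (GaloisGroupUnramifiedOutside K S) Λ 𝐃`,
`L : Specification S ρ`, `L.Q`, `L.QGlobal`, `L.phi`) over the `Λ`-adic local pairings `⟪·,·⟫_v` of
`TateDualLimitLocalPairing.lean` (torsion layers `E` of `toGaloisModule S ρ`, an arbitrary family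
`inv` of local invariant maps with the level-change law; the bridge `H¹(K_v, 𝐃) = (localRep S ρ v).H 1
≃ galoisCohomology ((toGaloisModule S ρ).toLocal v) 1` is `localHAddEquiv` of
`RestrictedRamificationBridge.lean`).  The `T*`-side data are CONSUMED THROUGH HYPOTHESES (no model
of `loc_v` on `H¹_cont(Γ_K, T*)` is fixed here): a family `yloc v ∈ H¹_cont(K_v, T*)` with
`yloc v ∈ L_v^⊥` (`hyL`), and — for the vanishing on `im φ_𝓛` — a global level-`k` companion
`y_k ∈ H¹(Γ_K, Hom(D_k, μ_{p^k}))` with `(yloc v)_k = loc_v y_k` (`hyk`), as supplied by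
`localProj_map_restrict` for `yloc v = loc_v y`, `y_k = H¹(proj_k) y`.

* `locCondition S ρ L v ≤ galoisCohomology ((toGaloisModule S ρ).toLocal v) 1` — `L(K_v, 𝐃)` read
  on the `Γ_{K_v}`-side (`comap` along `localHAddEquiv`);
* `localFunctional … v yv hyv : L.Q v →+ ℚ/ℤ`, `q ↦ ⟪q̃, yv⟫_v` (well defined since `yv ∈ L_v^⊥`);
  `globalFunctional … yloc hyL : L.QGlobal →+ ℚ/ℤ`, the sum over `v ∈ Σ` (`S` finite);
* **`globalFunctional_phi_eq_zero`** — `∑_v ⟪(φ_𝓛 x)_v, y_v⟫ = 0` for `x ∈ H¹(K_Σ/K, 𝐃)` admitting an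
  UNRAMIFIED LEVEL-`k` LIFT `x_k ∈ H¹(Γ_K, D_k)` of its inflation (hypothesis `hx`; for the layers
  `𝐃[𝔪ᵏ]` such lifts come from `H¹(G_Σ, 𝐃[𝔪ᵏ])`, `CoefficientLevels.exists_Hmap_subtype_eq_one`):
  Greenberg's "`G ⊥ G*`", the tree's `sum_limitPairing_eq_zero_of_level` (Poitou–Tate at level `k`);
* hence **`cokerFunctional … : (L.QGlobal ⧸ LinearMap.range L.phi) →+ ℚ/ℤ`** (Prop. 3.1.1's map)
  when every class has such a lift (`hlift`), with `cokerFunctional_mk`;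
* **`forall_limitPairing_eq_zero_of_globalFunctional_eq_zero`** — if the functional of `yloc`
  vanishes then `⟪t, yloc v⟫_v = 0` for every `v ∈ Σ` and every `t` (test on a vector supported at
  `v`), so `yloc v = 0` at the finite `v ∈ Σ` by right non-degeneracy
  (`eq_zero_of_forall_limitPairing_eq_zero`) — the kernel is `Ш¹`.

HONESTY: no case of Poitou–Tate duality, of Prop. 3.1.1/3.2.1 or of BSD is proved here; the
Poitou–Tate input enters through `inv`'s levelwise hypotheses.  AI formalisation, weaker than expert
review; the statements are established only by the kernel check.

## References
* R. Greenberg, *Surjectivity of the global-to-local map defining a Selmer group*, Kyoto J. Math.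
  50 (2010) 853–888, §3.1 p. 14, Prop. 3.1.1. [Greenberg2010]
* R. Greenberg, *On the structure of Selmer groups*, Springer PROMS 188 (2016), §2.6 Prop. 2.6.3.
  [Greenberg2016Selmer]
-/

noncomputable section

open scoped Classical
open Function CategoryTheory NumberField IsDedekindDomain Field
open _root_.TopRep _root_.ContRepresentation _root_.ContinuousCohomology
open Literature.NumberTheory.GaloisRepresentations
open Literature.NumberTheory.GaloisRepresentations.DiscreteGaloisModule
open Literature.NumberTheory.GaloisRepresentations.DiscreteGaloisModule.TorsionLayers
open Literature.NumberTheory.GaloisCohomology (LocalInvariants)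
open Literature.AnabelianGeometry.AbsoluteAnabelian.Prop121vii (zmodToQmodZ)

namespace Literature.NumberTheory.IwasawaTheory.Greenberg2016

variable {K : Type} [Field K] [NumberField K] (S : Set (HeightOneSpectrum (𝓞 K)))
  {Λ : Type} [CommRing Λ] [TopologicalSpace Λ]
  {D : Type} [AddCommGroup D] [Module Λ D] [TopologicalSpace D] [DiscreteTopology D]
  [ContinuousSMul Λ D]
  (ρ : ContinuousRep (GaloisGroupUnramifiedOutside K S) Λ D) (L : Specification S ρ)
  {p : ℕ} [NeZero p] (E : (toGaloisModule S ρ).TorsionLayers p)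
  (inv : ∀ k : ℕ, LocalInvariants K (p ^ k)) (hinv : ∀ v : Place K, InvLevelLaw inv v)

/-! ### §1. The local condition on the `Γ_{K_v}`-side and the local functional `q ↦ ⟪q̃, y_v⟫_v` -/

/-- **`L(K_v, 𝐃)` read on `galoisCohomology ((toGaloisModule S ρ).toLocal v) 1`** (pull-back along the
comparison `localHAddEquiv S ρ v 1`). [cite: Greenberg2010, §3.1 p. 14] -/
def locCondition (v : Place K) : AddSubgroup (galoisCohomology ((toGaloisModule S ρ).toLocal v) 1) :=
  (L v).toAddSubgroup.comap (localHAddEquiv S ρ v 1).toAddMonoidHom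

/-- Membership in `locCondition`. [cite: Greenberg2010, §3.1 p. 14] -/
@[simp] theorem mem_locCondition_iff (v : Place K)
    (t : galoisCohomology ((toGaloisModule S ρ).toLocal v) 1) :
    t ∈ locCondition S ρ L v ↔ localHAddEquiv S ρ v 1 t ∈ L v := Iff.rfl

variable {S ρ L E inv}

/-- **The local functional `Q_𝓛(K_v, 𝐃) → ℚ/ℤ`, `q ↦ ⟪q̃, y_v⟫_v`** for a local `T*`-class
`y_v ∈ L_v^⊥` (well defined: `⟪·, y_v⟫_v` kills `L_v`). [cite: Greenberg2010, §3.1 p. 14] -/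
def localFunctional (v : Place K)
    (yv : continuousCohomology 1 (E.localDualSystem v).limitRep.toTopRep)
    (hyv : yv ∈ E.dualLocalCondition inv v (locCondition S ρ L v)) : L.Q v →+ AddCircle (1 : ℚ) :=
  QuotientAddGroup.lift (L v).toAddSubgroup
    (((E.limitPairing inv v (hinv v)).flip yv).comp (localHAddEquiv S ρ v 1).symm.toAddMonoidHom)
    fun t ht => by
      rw [AddMonoidHom.mem_ker, AddMonoidHom.comp_apply, AddMonoidHom.flip_apply, limitPairing_apply]
      refine (TorsionLayers.mem_dualLocalCondition_iff _ _).1 hyv _ ?_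
      rw [mem_locCondition_iff]
      change localHAddEquiv S ρ v 1 ((localHAddEquiv S ρ v 1).symm t) ∈ L v
      rw [AddEquiv.apply_symm_apply]
      exact ht

/-- The local functional on a class: `q = [t] ↦ ⟪(localHAddEquiv)⁻¹ t, y_v⟫_v`.
[cite: Greenberg2010, §3.1 p. 14] -/
theorem localFunctional_mk (v : Place K)
    (yv : continuousCohomology 1 (E.localDualSystem v).limitRep.toTopRep)
    (hyv : yv ∈ E.dualLocalCondition inv v (locCondition S ρ L v)) (t : (localRep S ρ v).H 1) :
    localFunctional hinv v yv hyv (Submodule.Quotient.mk t) =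
      E.limitPairing inv v (hinv v) ((localHAddEquiv S ρ v 1).symm t) yv :=
  rfl

/-! ### §2. The global functional `t ↦ ∑_{v ∈ Σ} ⟪t_v, y_v⟫_v` on `Q_𝓛(K, 𝐃)` -/

/-- **`Q_𝓛(K, 𝐃) → ℚ/ℤ`, `t ↦ ∑_{v ∈ Σ} ⟪t̃_v, y_v⟫_v`** for a family of local `T*`-classes `y_v ∈ L_v^⊥`,
`v ∈ Σ` (`Σ` finite). [cite: Greenberg2010, §3.1 (9) p. 14] -/
def globalFunctional [Finite (SigmaPlace S)]
    (yloc : ∀ v : SigmaPlace S, continuousCohomology 1 (E.localDualSystem v.1).limitRep.toTopRep)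
    (hyL : ∀ v : SigmaPlace S, yloc v ∈ E.dualLocalCondition inv v.1 (locCondition S ρ L v.1)) :
    L.QGlobal →+ AddCircle (1 : ℚ) :=
  haveI := Fintype.ofFinite (SigmaPlace S)
  ∑ v : SigmaPlace S, (localFunctional hinv v.1 (yloc v) (hyL v)).comp
    (Pi.evalAddMonoidHom (fun w : SigmaPlace S => L.Q w.1) v)

/-- The global functional on a family of local classes: `∑_v` of the local functionals.
[cite: Greenberg2010, §3.1 (9) p. 14] -/
theorem globalFunctional_apply [Finite (SigmaPlace S)]
    (yloc : ∀ v : SigmaPlace S, continuousCohomology 1 (E.localDualSystem v.1).limitRep.toTopRep)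
    (hyL : ∀ v : SigmaPlace S, yloc v ∈ E.dualLocalCondition inv v.1 (locCondition S ρ L v.1))
    (q : L.QGlobal) :
    globalFunctional hinv yloc hyL q =
      haveI := Fintype.ofFinite (SigmaPlace S)
      ∑ v : SigmaPlace S, localFunctional hinv v.1 (yloc v) (hyL v) (q v) := by
  unfold globalFunctional
  rw [AddMonoidHom.finsetSum_apply]
  rfl

/-- **`G ⊥ G*`: the global functional kills `im φ_𝓛`** (Greenberg 2010 §3.1): for
`x ∈ H¹(K_Σ/K, 𝐃)` whose inflation to `Γ_K` lifts to an UNRAMIFIED-off-`Σ` class `x_k` of a level `D_k`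
(`hx`, `hxk`), and local classes `y_v` with a global level-`k` companion `y_k` (`hyk`, `hyur`),
`∑_{v ∈ Σ} ⟪(φ_𝓛 x)_v, y_v⟫_v = 0` — Poitou–Tate at the level `k` (`sum_limitPairing_eq_zero_of_level`).
[cite: Greenberg2010, §3.1 p. 14] [cite: MilneADT2006, Ch. I, Thm. 4.10(b)] -/
theorem globalFunctional_phi_eq_zero [Finite (SigmaPlace S)] (Sig : Finset (Place K))
    (hSig : ∀ v : Place K, v ∈ Sig ↔ InSigma S v)
    (hSp : ∀ w : HeightOneSpectrum (𝓞 K), ((p : ℕ) : 𝓞 K) ∈ w.asIdeal → w ∈ S) {k : ℕ}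
    (hPT : (inv k).SumLocalTermEqZero) (hUO : (inv k).UnramifiedOrthogonal)
    (hram : ∀ w : HeightOneSpectrum (𝓞 K), w ∉ S → GaloisRep.IsUnramifiedAt w (E.layerRep k))
    (yloc : ∀ v : SigmaPlace S, continuousCohomology 1 (E.localDualSystem v.1).limitRep.toTopRep)
    (hyL : ∀ v : SigmaPlace S, yloc v ∈ E.dualLocalCondition inv v.1 (locCondition S ρ L v.1))
    (yk : galoisCohomology (E.layerDualRep k) 1)
    (hyk : ∀ v : SigmaPlace S, E.localProj v.1 k (yloc v) =
      galoisCohomology.localization (E.layerDualRep k) v.1 1 yk)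
    (hyur : ∀ w : HeightOneSpectrum (𝓞 K), w ∉ S →
      haveI := E.finite k
      galoisCohomology.localization (E.layerDualRep k) (Sum.inr w) 1 yk ∈
        unramifiedSubgroup (GaloisRep.toLocal w ((E.layerRep k).tateDual (p ^ k))) 1)
    (x : ρ.H 1) (xk : galoisCohomology (E.layerRep k) 1)
    (hx : galoisCohomology.map (E.layerSubtypeHom k).hom 1 xk =
      (toGaloisModule S ρ).restrictedInf S 1 ((restrictedHAddEquiv S ρ 1).symm x))
    (hxk : ∀ w : HeightOneSpectrum (𝓞 K), w ∉ S →
      galoisCohomology.localization (E.layerRep k) (Sum.inr w) 1 xk ∈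
        unramifiedSubgroup (GaloisRep.toLocal w (E.layerRep k)) 1) :
    globalFunctional hinv yloc hyL (L.phi x) = 0 := by
  letI : Fintype (SigmaPlace S) := Fintype.ofFinite (SigmaPlace S)
  -- each term: `⟪(localHAddEquiv)⁻¹ (loc_v x), y_v⟫ = ⟪loc_v (inf x), y_v⟫ = ⟪loc_v ((D_k ⊆ D)_* x_k), y_v⟫`
  have hterm : ∀ v : SigmaPlace S, localFunctional hinv v.1 (yloc v) (hyL v) (L.phi x v) =
      E.limitPairing inv v.1 (hinv v.1)
        (galoisCohomology.localization (toGaloisModule S ρ) v.1 1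
          (galoisCohomology.map (E.layerSubtypeHom k).hom 1 xk)) (yloc v) := by
    intro v
    have ha : (localHAddEquiv S ρ v.1 1).symm (loc S ρ v.1 1 x) =
        galoisCohomology.localization (toGaloisModule S ρ) v.1 1
          ((toGaloisModule S ρ).restrictedInf S 1 ((restrictedHAddEquiv S ρ 1).symm x)) := by
      apply (localHAddEquiv S ρ v.1 1).injective
      rw [AddEquiv.apply_symm_apply, ← restrictedLocalization_apply, ← loc_restrictedHAddEquiv,
        AddEquiv.apply_symm_apply]
    rw [Specification.phi_apply, localFunctional_mk, ha, hx]
  rw [globalFunctional_apply, Finset.sum_congr rfl fun v _ => hterm v]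
  -- re-index the sum over `SigmaPlace S` by `Sig.attach` and apply the level-`k` sum formula
  have hsum := E.sum_limitPairing_eq_zero_of_level inv Sig (fun v _ => hinv v) hPT hUO
    (fun w => (hSig _).2 (inSigma_inl S w))
    (fun w hw => (hSig _).2 ((inSigma_inr_iff S w).2 (hSp w hw)))
    (fun w hw => hram w fun h => hw ((hSig _).2 ((inSigma_inr_iff S w).2 h))) xk yk
    (fun w hw => hxk w fun h => hw ((hSig _).2 ((inSigma_inr_iff S w).2 h)))
    (fun w hw => hyur w fun h => hw ((hSig _).2 ((inSigma_inr_iff S w).2 h)))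
    (fun v => if hv : InSigma S v then yloc ⟨v, hv⟩ else 0)
    (fun v hv => by rw [dif_pos ((hSig v).1 hv)]; exact hyk ⟨v, (hSig v).1 hv⟩)
  rw [Finset.attach_eq_univ] at hsum
  rw [← hsum]
  refine Fintype.sum_equiv (Equiv.subtypeEquivRight fun v => (hSig v).symm) _ _ fun v => ?_
  have hv : InSigma S ((Equiv.subtypeEquivRight (fun v => (hSig v).symm) v) : Place K) := v.2
  rw [dif_pos hv]
  rfl

/-! ### §3. The functional on `coker(φ_𝓛)` (Prop. 3.1.1's map) -/

/-- **`S_{𝓛*} → Hom(coker φ_𝓛, ℚ/ℤ)`, the map of Greenberg 2010 Prop. 3.1.1** for one family of local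
classes `y_v ∈ L_v^⊥`: the global functional descends to `coker(φ_𝓛) = Q_𝓛(K, 𝐃)/im φ_𝓛` once it kills
`im φ_𝓛` (`hker`, = `globalFunctional_phi_eq_zero` when every class has an unramified level lift).
[cite: Greenberg2010, Prop. 3.1.1 (p. 14)] -/
def cokerFunctional [Finite (SigmaPlace S)]
    (yloc : ∀ v : SigmaPlace S, continuousCohomology 1 (E.localDualSystem v.1).limitRep.toTopRep)
    (hyL : ∀ v : SigmaPlace S, yloc v ∈ E.dualLocalCondition inv v.1 (locCondition S ρ L v.1))
    (hker : ∀ x : ρ.H 1, globalFunctional hinv yloc hyL (L.phi x) = 0) :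
    (L.QGlobal ⧸ LinearMap.range L.phi) →+ AddCircle (1 : ℚ) :=
  QuotientAddGroup.lift (LinearMap.range L.phi).toAddSubgroup (globalFunctional hinv yloc hyL)
    fun q hq => by
      obtain ⟨x, rfl⟩ := (LinearMap.mem_range).1 ((Submodule.mem_toAddSubgroup _).1 hq)
      exact hker x

/-- The coker functional on a class `[q]` is the global functional at `q`.
[cite: Greenberg2010, Prop. 3.1.1 (p. 14)] -/
theorem cokerFunctional_mk [Finite (SigmaPlace S)]
    (yloc : ∀ v : SigmaPlace S, continuousCohomology 1 (E.localDualSystem v.1).limitRep.toTopRep)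
    (hyL : ∀ v : SigmaPlace S, yloc v ∈ E.dualLocalCondition inv v.1 (locCondition S ρ L v.1))
    (hker : ∀ x : ρ.H 1, globalFunctional hinv yloc hyL (L.phi x) = 0) (q : L.QGlobal) :
    cokerFunctional hinv yloc hyL hker (Submodule.Quotient.mk q) = globalFunctional hinv yloc hyL q :=
  rfl

/-- The coker functional vanishes iff the global functional does (every class of the cokernel is
represented). [cite: Greenberg2010, Prop. 3.1.1 (p. 14)] -/
theorem cokerFunctional_eq_zero_iff [Finite (SigmaPlace S)]
    (yloc : ∀ v : SigmaPlace S, continuousCohomology 1 (E.localDualSystem v.1).limitRep.toTopRep)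
    (hyL : ∀ v : SigmaPlace S, yloc v ∈ E.dualLocalCondition inv v.1 (locCondition S ρ L v.1))
    (hker : ∀ x : ρ.H 1, globalFunctional hinv yloc hyL (L.phi x) = 0) :
    cokerFunctional hinv yloc hyL hker = 0 ↔ globalFunctional hinv yloc hyL = 0 := by
  constructor
  · intro h
    refine AddMonoidHom.ext fun q => ?_
    rw [← cokerFunctional_mk hinv yloc hyL hker, h, AddMonoidHom.zero_apply, AddMonoidHom.zero_apply]
  · intro h
    refine AddMonoidHom.ext fun q => ?_
    obtain ⟨q, rfl⟩ := (LinearMap.range L.phi).mkQ_surjective q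
    rw [Submodule.mkQ_apply, cokerFunctional_mk, h, AddMonoidHom.zero_apply, AddMonoidHom.zero_apply]

/-! ### §4. The kernel: `Ш¹` (local test vectors, then right non-degeneracy) -/

/-- **If the global functional of `(y_v)` vanishes then `⟪t, y_v⟫_v = 0` for every `v ∈ Σ` and every
local class `t`** (evaluate on the vector supported at `v` with entry `[t]`).
[cite: Greenberg2010, §3.1 p. 14] -/
theorem limitPairing_eq_zero_of_globalFunctional_eq_zero [Finite (SigmaPlace S)]
    (yloc : ∀ v : SigmaPlace S, continuousCohomology 1 (E.localDualSystem v.1).limitRep.toTopRep)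
    (hyL : ∀ v : SigmaPlace S, yloc v ∈ E.dualLocalCondition inv v.1 (locCondition S ρ L v.1))
    (h0 : globalFunctional hinv yloc hyL = 0) (v : SigmaPlace S)
    (t : galoisCohomology ((toGaloisModule S ρ).toLocal v.1) 1) :
    E.limitPairing inv v.1 (hinv v.1) t (yloc v) = 0 := by
  letI : Fintype (SigmaPlace S) := Fintype.ofFinite (SigmaPlace S)
  have h := DFunLike.congr_fun h0
    (Pi.single v (Submodule.Quotient.mk (localHAddEquiv S ρ v.1 1 t)) : L.QGlobal)
  rw [globalFunctional_apply, AddMonoidHom.zero_apply,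
    Finset.sum_eq_single v (fun b _ hb => by rw [Pi.single_eq_of_ne hb, map_zero])
      (fun hv => absurd (Finset.mem_univ v) hv),
    Pi.single_eq_same, localFunctional_mk, AddEquiv.symm_apply_apply] at h
  exact h

/-- **At a finite place of `Σ` the kernel condition forces `y_v = 0`** (right non-degeneracy of the
`Λ`-adic local pairing, from the perfectness of the `inv k` at the finite places): the kernel of
`S_{𝓛*} → Hom(coker φ_𝓛, ℚ/ℤ)` lies in `Ш¹(K, Σ, T*)`. [cite: Greenberg2010, Prop. 3.1.1 (p. 14)]
[cite: MilneADT2006, Ch. I, Cor. 2.3] -/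
theorem eq_zero_of_globalFunctional_eq_zero_inr [Finite (SigmaPlace S)]
    (hperf : ∀ k, (inv k).IsPerfect)
    (yloc : ∀ v : SigmaPlace S, continuousCohomology 1 (E.localDualSystem v.1).limitRep.toTopRep)
    (hyL : ∀ v : SigmaPlace S, yloc v ∈ E.dualLocalCondition inv v.1 (locCondition S ρ L v.1))
    (h0 : globalFunctional hinv yloc hyL = 0) (w : HeightOneSpectrum (𝓞 K))
    (hw : InSigma S (Sum.inr w)) : yloc ⟨Sum.inr w, hw⟩ = 0 :=
  E.eq_zero_of_forall_limitPairing_eq_zero (hinv (Sum.inr w)) hperf (yloc ⟨Sum.inr w, hw⟩)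
    fun t => limitPairing_eq_zero_of_globalFunctional_eq_zero hinv yloc hyL h0 ⟨Sum.inr w, hw⟩ t

omit [NeZero p] [ContinuousSMul Λ D] in
/-- **At a complex place every class of `H¹_cont(K_w, T*)` vanishes** (`Γ_{K_w}` is trivial, the tree's
`eq_one_absoluteGaloisGroup_of_isComplex`; a continuous crossed homomorphism vanishes at `1`).
[cite: SerreGaloisCohomology1997, I §2.4] -/
theorem eq_zero_of_isComplex {w : InfinitePlace K} (hw : w.IsComplex)
    (y : continuousCohomology 1 (E.localDualSystem (Sum.inl w)).limitRep.toTopRep) : y = 0 := by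
  obtain ⟨ψ, rfl⟩ := oneCocycleClass_surjective _ y
  have hψ : ψ = 0 := Subtype.ext (ContinuousMap.ext fun σ => by
    rw [Literature.NumberTheory.GaloisCohomology.eq_one_absoluteGaloisGroup_of_isComplex hw σ,
      contOneCocycles.apply_one]
    rfl)
  rw [hψ, oneCocycleClass_zero]

/-- **For a totally complex `K`, the kernel condition forces `y_v = 0` at EVERY `v ∈ Σ`**: the kernel of
Prop. 3.1.1's map `S_{𝓛*}(K, T*) → coker(φ_𝓛)^∨` is (contained in) `Ш¹(K, Σ, T*)`.
[cite: Greenberg2010, Prop. 3.1.1 (p. 14)] -/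
theorem eq_zero_of_globalFunctional_eq_zero [IsTotallyComplex K] [Finite (SigmaPlace S)]
    (hperf : ∀ k, (inv k).IsPerfect)
    (yloc : ∀ v : SigmaPlace S, continuousCohomology 1 (E.localDualSystem v.1).limitRep.toTopRep)
    (hyL : ∀ v : SigmaPlace S, yloc v ∈ E.dualLocalCondition inv v.1 (locCondition S ρ L v.1))
    (h0 : globalFunctional hinv yloc hyL = 0) (v : SigmaPlace S) : yloc v = 0 := by
  obtain ⟨v, hv⟩ := v
  rcases v with w | w
  · exact eq_zero_of_isComplex (IsTotallyComplex.isComplex w) _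
  · exact eq_zero_of_globalFunctional_eq_zero_inr hinv hperf yloc hyL h0 w hv

end Literature.NumberTheory.IwasawaTheory.Greenberg2016
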